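import Literature.Computability.MetaComplexity.TwoModuliExpSums
import Literature.Analysis.Fourier.DiscreteFractalUncertaintyDolgopyat
import HarnessLib

/-!
# WalkHardFJLinOdd — the token dial, part N1: WEIGHTED two-moduli sums (per-coordinate weights in `ℤ/3`)

Cell `decomp-qadv`, lens 6 «barrier-complement carving», generation 19 (REV4 «FarFlipDial»).  Generic over a finite index type `ι`
(nothing here mentions the walk game); the input of the far-reader engine of parts N2–P.

The Literature lemma `TwoModuli.abs_three_mul_card_cell_sub_card_le` [ChattopadhyayWigderson2009, Lemma 5] counts the Hamming
weight mod `3` (all coordinate weights `1`) on a cell of `K` linear forms mod `p`.  The far-reader dial needs the JOINT distribution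
of several `ℤ/3`-valued WEIGHTED sums `u ↦ Σ_{i : u_i} W_j(i)` (weights `W_j(i) ∈ ℤ/3`, zeros allowed: the address of the swapped cut has
weights `2`/`1`, a far reader's gap functional is the indicator of its gap).  This part proves:
* `norm_one_add_weighted_le` — the one-coordinate factor `‖1 + χ_p(b)χ₃(m)‖ ≤ 2` if `m = 0`, `≤ 2cos(π/(3p))` if `m ≠ 0` (`3 ∤ p`; for
  `b = 0` via `2cos(π/3) = 1 ≤ 2cos(π/(3p))`);
* `norm_cubeSumW_le` — `‖Σ_u χ_p(Σ_{u_i} β_i)·χ₃(Σ_{u_i} m_i)‖ ≤ 2^{#{m_i = 0}}·(2cos(π/(3p)))^{#{m_i ≠ 0}}` (Riesz product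
  `TwoModuli.sum_bool_fun_prod`);
* `norm_sum_cell_weighted_le` — on a cell of `K` forms mod `p`: `‖Σ_{u ∈ cell} χ₃(Σ_{u_i} m_i)‖ ≤ 2^{|ι|}·cos(π/(3p))^{#{m_i ≠ 0}}`
  (`TwoModuli.sum_cell_eq_sum_twisted`);
* `abs_pow_mul_card_classW_sub_card_le` — the COUNTING form for `J` weighted functionals `W : Fin J → ι → ℤ/3` at once: if every
  non-trivial combination `Σ_j μ_j W_j` has at least `L` non-zero coordinates then
  `|3^J·#{u ∈ cell : W(u) = σ} − #cell| ≤ 3^J·2^{|ι|}·cos(π/(3p))^L` (orthogonality over `(ℤ/3)^J`, `TwoModuli.ite_eq_eq_sum_stdAddChar`);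
* `card_cell_le_pow_mul_card_classW` — the one-sided form used by the engine.

(Writer landing note: `‖χ_N(j)‖ = 1` is cited BY NAME as `DyatlovJin2018.Dolgopyat.norm_stdAddChar` from the Literature tree — gate dedup.)
-/

set_option autoImplicit false

open Finset Complex ZMod
open Literature.Computability.MetaComplexity.TwoModuli
open Literature.Analysis.Fourier.DyatlovJin2018.Dolgopyat (norm_stdAddChar)

namespace Summit.QuantumAdvantage.AdviceFreeQNC0.JLinPeel.TokenDial

section WeightedCube

variable {p : ℕ} [NeZero p] {ι : Type*} [Fintype ι] [DecidableEq ι]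

/-- `1 ≤ 2cos(π/(3p))` for `p ≥ 1`. -/
theorem one_le_two_mul_cos (p : ℕ) [NeZero p] : (1 : ℝ) ≤ 2 * Real.cos (Real.pi / (3 * p)) := by
  have hp1 : (1 : ℝ) ≤ p := by exact_mod_cast Nat.pos_of_ne_zero (NeZero.ne p)
  have hle : Real.pi / (3 * p) ≤ Real.pi / 3 := by
    apply div_le_div_of_nonneg_left Real.pi_pos.le (by norm_num)
    linarith
  have := Real.cos_le_cos_of_nonneg_of_le_pi (by positivity) (by linarith [Real.pi_pos]) hle
  rw [Real.cos_pi_div_three] at this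
  linarith

/-- **the one-coordinate factor with a weight `m ∈ ℤ/3`:** `‖1 + χ_p(b)χ₃(m)‖ ≤ 2` if `m = 0` and `≤ 2cos(π/(3p))` if `m ≠ 0`
(`3 ∤ p`; any `b`). -/
theorem norm_one_add_weighted_le (hp3 : p.Coprime 3) (b : ZMod p) (m : ZMod 3) :
    ‖(1 : ℂ) + stdAddChar b * stdAddChar m‖ ≤ if m = 0 then (2 : ℝ) else 2 * Real.cos (Real.pi / (3 * p)) := by
  split_ifs with hm
  · calc ‖(1 : ℂ) + stdAddChar b * stdAddChar m‖
        ≤ ‖(1 : ℂ)‖ + ‖(stdAddChar b : ℂ) * stdAddChar m‖ := norm_add_le _ _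
      _ = 2 := by rw [norm_mul, norm_stdAddChar, norm_stdAddChar]; norm_num
  · by_cases hb : b = 0
    · rw [hb, AddChar.map_zero_eq_one, one_mul]
      have h := norm_one_add_stdAddChar_le (p := 3) hm
      simp only [Nat.cast_ofNat, Real.cos_pi_div_three] at h
      linarith [one_le_two_mul_cos p]
    · have h := norm_one_add_stdAddChar_mul_stdAddChar_le hp3 hb m
      simp only [Nat.cast_ofNat] at h
      rwa [show ((p : ℝ) * 3) = 3 * p by ring] at h

/-- **WEIGHTED two-moduli cube sum:** `‖Σ_u χ_p(Σ_{u_i} β_i)·χ₃(Σ_{u_i} m_i)‖ ≤ 2^{#{m_i = 0}}·(2cos(π/(3p)))^{#{m_i ≠ 0}}`. -/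
theorem norm_cubeSumW_le (hp3 : p.Coprime 3) (β : ι → ZMod p) (m : ι → ZMod 3) :
    ‖∑ u : ι → Bool, (stdAddChar (∑ i, if u i then β i else 0) : ℂ) *
        (stdAddChar (∑ i, if u i then m i else 0) : ℂ)‖
      ≤ (2 : ℝ) ^ (univ.filter fun i => m i = 0).card *
          (2 * Real.cos (Real.pi / (3 * p))) ^ (univ.filter fun i => ¬ m i = 0).card := by
  have hterm : ∀ u : ι → Bool, (stdAddChar (∑ i, if u i then β i else 0) : ℂ) *
      (stdAddChar (∑ i, if u i then m i else 0) : ℂ)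
      = ∏ i, (fun (i : ι) (b : Bool) => if b then (stdAddChar (β i) : ℂ) * stdAddChar (m i) else 1) i (u i) := by
    intro u
    rw [stdAddChar_sum_ite, stdAddChar_sum_ite, ← prod_mul_distrib]
    refine prod_congr rfl fun i _ => ?_
    cases u i <;> simp
  simp_rw [hterm]
  rw [sum_bool_fun_prod (fun (i : ι) (b : Bool) => if b then (stdAddChar (β i) : ℂ) * stdAddChar (m i) else 1),
    Complex.norm_prod]
  calc ∏ i, ‖(fun (i : ι) (b : Bool) => if b then (stdAddChar (β i) : ℂ) * stdAddChar (m i) else 1) i false +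
          (fun (i : ι) (b : Bool) => if b then (stdAddChar (β i) : ℂ) * stdAddChar (m i) else 1) i true‖
      ≤ ∏ i, (if m i = 0 then (2 : ℝ) else 2 * Real.cos (Real.pi / (3 * p))) :=
        prod_le_prod (fun i _ => norm_nonneg _) fun i _ => by
          simpa using norm_one_add_weighted_le hp3 (β i) (m i)
    _ = _ := by rw [prod_ite, prod_const, prod_const]

/-- **weighted sum on a cell of `K` linear forms mod `p`:** `‖Σ_{u : ℓ(u) = v} χ₃(Σ_{u_i} m_i)‖ ≤ 2^{|ι|}·cos(π/(3p))^{#{m_i ≠ 0}}`. -/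
theorem norm_sum_cell_weighted_le (hp3 : p.Coprime 3) {K : ℕ} (lam : Fin K → ι → ZMod p) (v : Fin K → ZMod p)
    (m : ι → ZMod 3) :
    ‖∑ u ∈ univ.filter (fun u : ι → Bool => (fun j => ∑ i, if u i then lam j i else 0) = v),
        (stdAddChar (∑ i, if u i then m i else 0) : ℂ)‖
      ≤ (2 : ℝ) ^ Fintype.card ι * Real.cos (Real.pi / (3 * p)) ^ (univ.filter fun i => ¬ m i = 0).card := by
  have hpR : (0 : ℝ) < p := by exact_mod_cast NeZero.pos p
  have hexp : (∑ u ∈ univ.filter (fun u : ι → Bool => (fun j => ∑ i, if u i then lam j i else 0) = v),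
        (stdAddChar (∑ i, if u i then m i else 0) : ℂ))
      = ((p : ℂ) ^ K)⁻¹ * ∑ γ : Fin K → ZMod p, (stdAddChar (-∑ j, γ j * v j) : ℂ) *
          ∑ u : ι → Bool, (stdAddChar (∑ i, if u i then ∑ j, γ j * lam j i else 0) : ℂ) *
            (stdAddChar (∑ i, if u i then m i else 0) : ℂ) := by
    rw [sum_filter]
    exact sum_cell_eq_sum_twisted lam v _
  rw [hexp, norm_mul, norm_inv, norm_pow, Complex.norm_natCast]
  have hsplit : (2 : ℝ) ^ Fintype.card ι * Real.cos (Real.pi / (3 * p)) ^ (univ.filter fun i => ¬ m i = 0).card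
      = (2 : ℝ) ^ (univ.filter fun i => m i = 0).card *
          (2 * Real.cos (Real.pi / (3 * p))) ^ (univ.filter fun i => ¬ m i = 0).card := by
    rw [mul_pow, ← mul_assoc, ← pow_add, card_filter_add_card_filter_not, card_univ]
  have hT : ∀ γ : Fin K → ZMod p, ‖∑ u : ι → Bool,
      (stdAddChar (∑ i, if u i then ∑ j, γ j * lam j i else 0) : ℂ) * (stdAddChar (∑ i, if u i then m i else 0) : ℂ)‖
      ≤ (2 : ℝ) ^ Fintype.card ι * Real.cos (Real.pi / (3 * p)) ^ (univ.filter fun i => ¬ m i = 0).card := by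
    intro γ
    rw [hsplit]
    exact norm_cubeSumW_le hp3 (fun i => ∑ j, γ j * lam j i) m
  calc ((p : ℝ) ^ K)⁻¹ * ‖∑ γ : Fin K → ZMod p, (stdAddChar (-∑ j, γ j * v j) : ℂ) *
          ∑ u : ι → Bool, (stdAddChar (∑ i, if u i then ∑ j, γ j * lam j i else 0) : ℂ) *
            (stdAddChar (∑ i, if u i then m i else 0) : ℂ)‖
      ≤ ((p : ℝ) ^ K)⁻¹ * ∑ γ : Fin K → ZMod p,
          (2 : ℝ) ^ Fintype.card ι * Real.cos (Real.pi / (3 * p)) ^ (univ.filter fun i => ¬ m i = 0).card := by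
        gcongr
        refine (norm_sum_le _ _).trans (sum_le_sum fun γ _ => ?_)
        rw [norm_mul, norm_stdAddChar, one_mul]
        exact hT γ
    _ = (2 : ℝ) ^ Fintype.card ι * Real.cos (Real.pi / (3 * p)) ^ (univ.filter fun i => ¬ m i = 0).card := by
        rw [sum_const, card_univ, Fintype.card_fun, ZMod.card, Fintype.card_fin, nsmul_eq_mul, Nat.cast_pow,
          ← mul_assoc, inv_mul_cancel₀ (pow_ne_zero _ hpR.ne'), one_mul]

/-- the combined weights of a combination `μ` of the functionals `W`. -/
def combW {J : ℕ} (μ : Fin J → ZMod 3) (W : Fin J → ι → ZMod 3) : ι → ZMod 3 := fun i => ∑ j, μ j * W j i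

omit [DecidableEq ι] in
/-- a combination of the functional values is the weighted sum with the combined weights. -/
theorem sum_mul_functional_eq {J : ℕ} (μ : Fin J → ZMod 3) (W : Fin J → ι → ZMod 3) (u : ι → Bool) :
    (∑ j, μ j * (∑ i, if u i then W j i else 0)) = ∑ i, if u i then combW μ W i else 0 := by
  unfold combW
  simp_rw [mul_sum]
  rw [sum_comm]
  refine sum_congr rfl fun i _ => ?_
  split_ifs with h
  · rfl
  · simp

/-- **JOINT COUNT of `J` weighted functionals mod `3` on a cell of `K` linear forms mod `p`** (`3 ∤ p`): if every non-trivial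
combination `Σ_j μ_j W_j` has at least `L` non-zero coordinates then every value `σ ∈ (ℤ/3)^J` is taken on
`#cell/3^J ± 2^{|ι|}·cos(π/(3p))^L` points of the cell. -/
theorem abs_pow_mul_card_classW_sub_card_le (hp3 : p.Coprime 3) {K J : ℕ} (lam : Fin K → ι → ZMod p)
    (v : Fin K → ZMod p) (W : Fin J → ι → ZMod 3) (σ : Fin J → ZMod 3) (L : ℕ)
    (hL : ∀ μ : Fin J → ZMod 3, μ ≠ 0 → L ≤ (univ.filter fun i => ¬ combW μ W i = 0).card) :
    |(3 : ℝ) ^ J * ((univ.filter fun u : ι → Bool =>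
          (fun j => ∑ i, if u i then W j i else 0) = σ ∧ (fun j => ∑ i, if u i then lam j i else 0) = v).card : ℝ)
        - ((univ.filter fun u : ι → Bool => (fun j => ∑ i, if u i then lam j i else 0) = v).card : ℝ)|
      ≤ (3 : ℝ) ^ J * (2 : ℝ) ^ Fintype.card ι * Real.cos (Real.pi / (3 * p)) ^ L := by
  set Sv := univ.filter (fun u : ι → Bool => (fun j => ∑ i, if u i then lam j i else 0) = v) with hSv
  have hcos0 : 0 ≤ Real.cos (Real.pi / (3 * p)) := by
    have h1 := one_le_two_mul_cos p
    linarith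
  have hcos1 : Real.cos (Real.pi / (3 * p)) ≤ 1 := Real.cos_le_one _
  -- the joint count as a sum over the cell of the class indicator, expanded over the characters of `(ℤ/3)^J`
  have hjoint : ((univ.filter fun u : ι → Bool =>
          (fun j => ∑ i, if u i then W j i else 0) = σ ∧ (fun j => ∑ i, if u i then lam j i else 0) = v).card : ℂ)
      = ∑ u ∈ Sv, (if (fun j => ∑ i, if u i then W j i else 0) = σ then (1 : ℂ) else 0) := by
    rw [natCast_card_filter, hSv, sum_filter]
    refine sum_congr rfl fun u _ => ?_
    by_cases h1 : (fun j => ∑ i, if u i then W j i else 0) = σ <;>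
      by_cases h2 : (fun j => ∑ i, if u i then lam j i else 0) = v <;> simp [h1, h2]
  have hind : ∀ u : ι → Bool, (if (fun j => ∑ i, if u i then W j i else 0) = σ then (1 : ℂ) else 0)
      = ((3 : ℂ) ^ J)⁻¹ * ∑ μ : Fin J → ZMod 3, (stdAddChar (-∑ j, μ j * σ j) : ℂ) *
          (stdAddChar (∑ i, if u i then combW μ W i else 0) : ℂ) := by
    intro u
    rw [ite_eq_eq_sum_stdAddChar (p := 3) (fun j => ∑ i, if u i then W j i else 0) σ]
    push_cast
    congr 1
    refine sum_congr rfl fun μ _ => ?_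
    rw [← AddChar.map_add_eq_mul, ← sum_mul_functional_eq μ W u]
    congr 1
    simp only [mul_sub, sum_sub_distrib]
    ring
  have hexp : ∑ u ∈ Sv, (if (fun j => ∑ i, if u i then W j i else 0) = σ then (1 : ℂ) else 0)
      = ((3 : ℂ) ^ J)⁻¹ * ∑ μ : Fin J → ZMod 3, (stdAddChar (-∑ j, μ j * σ j) : ℂ) *
          ∑ u ∈ Sv, (stdAddChar (∑ i, if u i then combW μ W i else 0) : ℂ) := by
    simp_rw [hind]
    rw [← mul_sum, sum_comm]
    congr 1
    refine sum_congr rfl fun μ _ => ?_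
    rw [mul_sum]
  -- the trivial character gives the cell size
  have hzero : (stdAddChar (-∑ j, (0 : Fin J → ZMod 3) j * σ j) : ℂ) *
      ∑ u ∈ Sv, (stdAddChar (∑ i, if u i then combW 0 W i else 0) : ℂ) = (Sv.card : ℂ) := by
    have h0 : ∀ i, combW (0 : Fin J → ZMod 3) W i = 0 := fun i => by unfold combW; simp
    simp [h0]
  have hsplit : ∑ μ : Fin J → ZMod 3, (stdAddChar (-∑ j, μ j * σ j) : ℂ) *
        ∑ u ∈ Sv, (stdAddChar (∑ i, if u i then combW μ W i else 0) : ℂ)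
      = (Sv.card : ℂ) + ∑ μ ∈ univ.erase (0 : Fin J → ZMod 3), (stdAddChar (-∑ j, μ j * σ j) : ℂ) *
          ∑ u ∈ Sv, (stdAddChar (∑ i, if u i then combW μ W i else 0) : ℂ) := by
    rw [← add_sum_erase univ _ (mem_univ (0 : Fin J → ZMod 3)), hzero]
  have h3J : ((3 : ℂ) ^ J) ≠ 0 := pow_ne_zero _ (by norm_num)
  have hdiff : (3 : ℂ) ^ J * ((univ.filter fun u : ι → Bool =>
          (fun j => ∑ i, if u i then W j i else 0) = σ ∧ (fun j => ∑ i, if u i then lam j i else 0) = v).card : ℂ)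
        - (Sv.card : ℂ)
      = ∑ μ ∈ univ.erase (0 : Fin J → ZMod 3), (stdAddChar (-∑ j, μ j * σ j) : ℂ) *
          ∑ u ∈ Sv, (stdAddChar (∑ i, if u i then combW μ W i else 0) : ℂ) := by
    rw [hjoint, hexp, hsplit, ← mul_assoc, mul_inv_cancel₀ h3J, one_mul]
    ring
  have hbound : ‖∑ μ ∈ univ.erase (0 : Fin J → ZMod 3), (stdAddChar (-∑ j, μ j * σ j) : ℂ) *
          ∑ u ∈ Sv, (stdAddChar (∑ i, if u i then combW μ W i else 0) : ℂ)‖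
      ≤ (3 : ℝ) ^ J * (2 : ℝ) ^ Fintype.card ι * Real.cos (Real.pi / (3 * p)) ^ L := by
    calc ‖∑ μ ∈ univ.erase (0 : Fin J → ZMod 3), (stdAddChar (-∑ j, μ j * σ j) : ℂ) *
            ∑ u ∈ Sv, (stdAddChar (∑ i, if u i then combW μ W i else 0) : ℂ)‖
        ≤ ∑ μ ∈ univ.erase (0 : Fin J → ZMod 3), (2 : ℝ) ^ Fintype.card ι * Real.cos (Real.pi / (3 * p)) ^ L := by
          refine (norm_sum_le _ _).trans (sum_le_sum fun μ hμ => ?_)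
          rw [norm_mul, norm_stdAddChar, one_mul, hSv]
          refine (norm_sum_cell_weighted_le hp3 lam v (combW μ W)).trans ?_
          exact mul_le_mul_of_nonneg_left (pow_le_pow_of_le_one hcos0 hcos1 (hL μ (mem_erase.mp hμ).1))
            (by positivity)
      _ ≤ ∑ _μ : Fin J → ZMod 3, (2 : ℝ) ^ Fintype.card ι * Real.cos (Real.pi / (3 * p)) ^ L :=
          sum_le_sum_of_subset_of_nonneg (erase_subset _ _) fun _ _ _ => by positivity
      _ = (3 : ℝ) ^ J * (2 : ℝ) ^ Fintype.card ι * Real.cos (Real.pi / (3 * p)) ^ L := by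
          rw [sum_const, card_univ, Fintype.card_fun, ZMod.card, Fintype.card_fin, nsmul_eq_mul, Nat.cast_pow]
          push_cast
          ring
  have key : |(3 : ℝ) ^ J * ((univ.filter fun u : ι → Bool =>
          (fun j => ∑ i, if u i then W j i else 0) = σ ∧ (fun j => ∑ i, if u i then lam j i else 0) = v).card : ℝ)
        - (Sv.card : ℝ)|
      = ‖(3 : ℂ) ^ J * ((univ.filter fun u : ι → Bool =>
          (fun j => ∑ i, if u i then W j i else 0) = σ ∧ (fun j => ∑ i, if u i then lam j i else 0) = v).card : ℂ)
        - (Sv.card : ℂ)‖ := by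
    rw [← Real.norm_eq_abs, ← Complex.norm_real]; push_cast; rfl
  rw [key, hdiff]
  exact hbound

/-- **one-sided form:** `#cell ≤ 3^J·#{u ∈ cell : W(u) = σ} + 3^J·2^{|ι|}·cos(π/(3p))^L`. -/
theorem card_cell_le_pow_mul_card_classW (hp3 : p.Coprime 3) {K J : ℕ} (lam : Fin K → ι → ZMod p)
    (v : Fin K → ZMod p) (W : Fin J → ι → ZMod 3) (σ : Fin J → ZMod 3) (L : ℕ)
    (hL : ∀ μ : Fin J → ZMod 3, μ ≠ 0 → L ≤ (univ.filter fun i => ¬ combW μ W i = 0).card) :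
    ((univ.filter fun u : ι → Bool => (fun j => ∑ i, if u i then lam j i else 0) = v).card : ℝ)
      ≤ (3 : ℝ) ^ J * ((univ.filter fun u : ι → Bool =>
          (fun j => ∑ i, if u i then W j i else 0) = σ ∧ (fun j => ∑ i, if u i then lam j i else 0) = v).card : ℝ)
        + (3 : ℝ) ^ J * (2 : ℝ) ^ Fintype.card ι * Real.cos (Real.pi / (3 * p)) ^ L := by
  have h := abs_pow_mul_card_classW_sub_card_le hp3 lam v W σ L hL
  have := (abs_le.mp h).1
  linarith

end WeightedCube

end Summit.QuantumAdvantage.AdviceFreeQNC0.JLinPeel.TokenDial
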